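/-
Copyright: statement-level skeleton of a published paper (lit-balaban cell, Phase-2 proof seat p13, gen 6). No proof
claims beyond what the kernel checks below.
-/
import Literature.MathematicalPhysics.QuantumFieldTheory.BalabanImbrieJaffe1984to88.BIJ88CsClusters306

/-!
# `BalabanImbrieJaffe1984to88.BIJ88AbutRange306` — T. Bałaban, J. Imbrie, A. Jaffe, *Effective action and cluster
properties of the abelian Higgs model*, Commun. Math. Phys. **114** (1988) 257–315 [BalabanImbrieJaffe1988], §5.13
p. 306 [PDF 50]: **"The form Δ has a range less than ½r(e_k). The f(□_i) do not couple different □_i. Hence only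
adjacent □_j with s_j ≠ 0 interact in the above formula. … (Here we say that □_i is connected to □_{i′} if they abut
on a hypersurface of any dimension.)"** — the GEOMETRIC STEP PROVED: for sites with integer coordinates partitioned
into cubes of side `r` (the elementary `r(e_k)`-cubes), a form `Δ` of range `< r` couples two sites only if their
cubes coincide or ABUT (differ by at most one in every coordinate of the cube index — adjacency through a face, an
edge, …, a vertex: *"a hypersurface of any dimension"*).  This discharges the abstract range hypothesis `hΔ` of
`…BIJ88CsClusters306.interpForm_blockDiag` / `cs_apply_eq_zero_of_not_reachable` (p255115) from the printed one.

statement-level skeleton of published theorems with citation tags; proofs where landed; nothing here is a claim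
about the Yang–Mills mass gap

PDF held: `paper:balaban1988-cmp114-bij-abelian-higgs-effective-action` (journal page = PDF page + 256; p. 306 read with
`lit read … --pages 50`).

CITATION HEADER (lean-in-tree rule).  lit-balaban cell (HOME `run/shared/lean/pub/lit-balaban/`), Phase 2, seat p13
gen 6 (unit `lit-balaban-p13-g6`); seventh file of the p. 305–306 group; row **C2.Eq5.13.3-5.13.4** of
`HOME/lit-balaban-r16/ROWS-C2-part2.md` (owner r16, referee ref-5), the p. 306 member quoted above.  USED BY NAME,
nothing restated: `…BIJ88CsClusters306` (`interpForm_blockDiag`, `cs_apply_eq_zero_of_cluster_ne`,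
`cs_apply_eq_zero_of_not_reachable` — there the adjacency `adj` and the hypothesis "Δ couples only equal or adjacent
regions" are abstract), `…BIJ88DirichletForms305` (`interpForm`).

## What is proved (0 `sorry`, standard axioms, theorems only, no new `def`)

Sites `α` with integer coordinates `pos : α → ℤ^d`, a finite region index type `I` with cube indices
`idx : I → ℤ^d`, cube side `r > 0`, and the CUBE HYPOTHESIS `r·idx(blk x)_μ ≤ pos(x)_μ < r·idx(blk x)_μ + r` (site
`x` lies in the cube `□_{blk x}`).  "Abut" is written inline as `∀ μ, |idx i μ − idx i′ μ| ≤ 1`.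
* §1 `abs_sub_idx_le_one_of_close` (one coordinate), **`abut_of_close`**: `|pos x − pos y|_∞ < r ⇒` the cubes of
  `x` and `y` coincide or abut.
* §2 **`blockHyp_of_range`**: a form of range `< r` (`Δ x y ≠ 0 ⇒ |pos x − pos y|_∞ < r`; the printed range
  `< ½r(e_k)` is stronger) couples only equal or abutting cubes — the hypothesis `hΔ` of `BIJ88CsClusters306`.
* §3 THE PRINTED CONCLUSIONS WITH THE PRINTED HYPOTHESIS: `interpForm_blockDiag_of_range` (`Δ_s` is block-diagonal
  over every cluster labelling constant on abutting pairs with `s ≠ 0`), `cs_apply_eq_zero_of_cluster_ne_of_range`,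
  **`cs_apply_eq_zero_of_not_reachable_of_range`** (`C_s = Δ_s⁻¹` does not couple cubes in different connected
  components of the graph "s_i ≠ 0 ∧ s_j ≠ 0 ∧ □_i, □_j abut" — *"factorizes over the connected components"*).
HONEST SCOPE.  Pure lattice geometry + the linear algebra of p255115; the cubes are axis-parallel of common side `r`
on the lattice `rℤ^d` (as the elementary `r(e_k)`-cubes of p. 303); nothing about the measure.  NOT summit progress;
NOT continuum; NOT Clay.  Imports `BIJ88CsClusters306`; modifies nothing.
-/

namespace Literature.MathematicalPhysics.QuantumFieldTheory.BalabanImbrieJaffe1984to88.BIJ88AbutRange306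

open Matrix Finset
open BIJ88DirichletForms305 (interpForm)
open BIJ88CsClusters306 (interpForm_blockDiag cs_apply_eq_zero_of_cluster_ne cs_apply_eq_zero_of_not_reachable)

/-! ## §1  Close sites lie in equal or abutting cubes -/

/-- One coordinate: if `x ∈ [ri, ri + r)`, `y ∈ [ri′, ri′ + r)` and `|x − y| < r` then `|i − i′| ≤ 1`.
[cite: BalabanImbrieJaffe1988, §5.13 p.306] -/
theorem abs_sub_idx_le_one_of_close {r i i' x y : ℤ} (hr : 0 < r) (hx : r * i ≤ x ∧ x < r * i + r)
    (hy : r * i' ≤ y ∧ y < r * i' + r) (hxy : |x - y| < r) : |i - i'| ≤ 1 := by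
  rw [abs_lt] at hxy
  rw [abs_le]
  constructor
  · by_contra h
    have h2 : i + 2 ≤ i' := by omega
    have h3 : r * i + r * 2 ≤ r * i' := by
      have := mul_le_mul_of_nonneg_left h2 hr.le
      rwa [mul_add] at this
    linarith [hx.2, hy.1, hxy.1]
  · by_contra h
    have h2 : i' + 2 ≤ i := by omega
    have h3 : r * i' + r * 2 ≤ r * i := by
      have := mul_le_mul_of_nonneg_left h2 hr.le
      rwa [mul_add] at this
    linarith [hx.1, hy.2, hxy.2]

section Cubes

variable {α I : Type*} {d : ℕ} (blk : α → I) (pos : α → Fin d → ℤ) (idx : I → Fin d → ℤ)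

/-- **Close sites lie in equal or abutting cubes**: under the cube hypothesis (site `x` lies in the side-`r` cube of
index `idx (blk x)`), `|pos x − pos y|_∞ < r` forces `|idx(blk x)_μ − idx(blk y)_μ| ≤ 1` for every `μ` — the cubes
*"abut on a hypersurface of any dimension"* (or coincide). [cite: BalabanImbrieJaffe1988, §5.13 p.306] -/
theorem abut_of_close {r : ℤ} (hr : 0 < r)
    (hcube : ∀ x μ, r * idx (blk x) μ ≤ pos x μ ∧ pos x μ < r * idx (blk x) μ + r) {x y : α}
    (hxy : ∀ μ, |pos x μ - pos y μ| < r) (μ : Fin d) : |idx (blk x) μ - idx (blk y) μ| ≤ 1 :=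
  abs_sub_idx_le_one_of_close hr (hcube x μ) (hcube y μ) (hxy μ)

/-! ## §2  A finite-range form couples only equal or abutting cubes -/

/-- **"The form Δ has a range less than ½r(e_k). … Hence only adjacent □_j … interact"** — the geometric step: a
form of range `< r` (a fortiori `< ½r`) vanishes between sites whose cubes neither coincide nor abut; this is the
hypothesis `hΔ` of `BIJ88CsClusters306.interpForm_blockDiag` with `adj i i′ := ∀ μ, |idx i μ − idx i′ μ| ≤ 1`.
[cite: BalabanImbrieJaffe1988, §5.13 p.306] -/
theorem blockHyp_of_range {R : Type*} [Zero R] (Δ : Matrix α α R) {r : ℤ} (hr : 0 < r)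
    (hcube : ∀ x μ, r * idx (blk x) μ ≤ pos x μ ∧ pos x μ < r * idx (blk x) μ + r)
    (hΔ : ∀ x y, Δ x y ≠ 0 → ∀ μ, |pos x μ - pos y μ| < r) :
    ∀ x y, blk x ≠ blk y → ¬ (∀ μ, |idx (blk x) μ - idx (blk y) μ| ≤ 1) → Δ x y = 0 := by
  intro x y _ hnot
  by_contra h
  exact hnot (abut_of_close blk pos idx hr hcube (hΔ x y h))

end Cubes

/-! ## §3  The printed conclusions under the printed (range) hypothesis -/

section Range

variable {α I R : Type*} [Fintype α] [DecidableEq α] [DecidableEq I] [Fintype I] [CommRing R]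
  (blk : α → I) {d : ℕ} (pos : α → Fin d → ℤ) (idx : I → Fin d → ℤ)

/-- **`Δ_s` is block-diagonal over clusters, from the range hypothesis**: cubes of side `r`, `Δ` of range `< r`, a
cluster labelling `cls` constant on abutting pairs of cubes with `s ≠ 0` ⇒ `(Δ_s)_{xy} = 0` whenever the cubes of
`x`, `y` lie in different clusters. [cite: BalabanImbrieJaffe1988, §5.13 p.306] -/
theorem interpForm_blockDiag_of_range {K : Type*} (Δ : Matrix α α R) (s : I → R) {r : ℤ} (hr : 0 < r)
    (hcube : ∀ x μ, r * idx (blk x) μ ≤ pos x μ ∧ pos x μ < r * idx (blk x) μ + r)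
    (hΔ : ∀ x y, Δ x y ≠ 0 → ∀ μ, |pos x μ - pos y μ| < r) (cls : I → K)
    (hcls : ∀ i j, i ≠ j → s i ≠ 0 → s j ≠ 0 → (∀ μ, |idx i μ - idx j μ| ≤ 1) → cls i = cls j) {x y : α}
    (hxy : cls (blk x) ≠ cls (blk y)) : interpForm blk Δ s x y = 0 :=
  interpForm_blockDiag blk Δ s (fun i j => ∀ μ, |idx i μ - idx j μ| ≤ 1)
    (blockHyp_of_range blk pos idx Δ hr hcube hΔ) cls hcls hxy

/-- **`C_s = Δ_s⁻¹` does not couple different clusters** (range hypothesis version).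
[cite: BalabanImbrieJaffe1988, §5.13 p.306] -/
theorem cs_apply_eq_zero_of_cluster_ne_of_range {K : Type*} (Δ : Matrix α α R) (s : I → R) {r : ℤ} (hr : 0 < r)
    (hcube : ∀ x μ, r * idx (blk x) μ ≤ pos x μ ∧ pos x μ < r * idx (blk x) μ + r)
    (hΔ : ∀ x y, Δ x y ≠ 0 → ∀ μ, |pos x μ - pos y μ| < r) (cls : I → K)
    (hcls : ∀ i j, i ≠ j → s i ≠ 0 → s j ≠ 0 → (∀ μ, |idx i μ - idx j μ| ≤ 1) → cls i = cls j) {x y : α}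
    (hxy : cls (blk x) ≠ cls (blk y)) : (interpForm blk Δ s)⁻¹ x y = 0 :=
  cs_apply_eq_zero_of_cluster_ne blk Δ s (fun i j => ∀ μ, |idx i μ - idx j μ| ≤ 1)
    (blockHyp_of_range blk pos idx Δ hr hcube hΔ) cls hcls hxy

/-- **"factorizes over the connected components … (□_i is connected to □_{i′} if they abut on a hypersurface of any
dimension)"** with the printed hypothesis: cubes of side `r`, `Δ` of range `< r` ⇒ `C_s = Δ_s⁻¹` vanishes between sites
whose cubes are not joined by a chain of abutting cubes with `s ≠ 0` (connected components of
`SimpleGraph.fromRel (s_i ≠ 0 ∧ s_j ≠ 0 ∧ □_i, □_j abut)`). [cite: BalabanImbrieJaffe1988, §5.13 p.306] -/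
theorem cs_apply_eq_zero_of_not_reachable_of_range (Δ : Matrix α α R) (s : I → R) {r : ℤ} (hr : 0 < r)
    (hcube : ∀ x μ, r * idx (blk x) μ ≤ pos x μ ∧ pos x μ < r * idx (blk x) μ + r)
    (hΔ : ∀ x y, Δ x y ≠ 0 → ∀ μ, |pos x μ - pos y μ| < r) {x y : α}
    (hxy : ¬ (SimpleGraph.fromRel fun i j : I =>
      s i ≠ 0 ∧ s j ≠ 0 ∧ ∀ μ, |idx i μ - idx j μ| ≤ 1).Reachable (blk x) (blk y)) :
    (interpForm blk Δ s)⁻¹ x y = 0 :=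
  cs_apply_eq_zero_of_not_reachable blk Δ s (fun i j => ∀ μ, |idx i μ - idx j μ| ≤ 1)
    (blockHyp_of_range blk pos idx Δ hr hcube hΔ) hxy

end Range

end Literature.MathematicalPhysics.QuantumFieldTheory.BalabanImbrieJaffe1984to88.BIJ88AbutRange306
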